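import Literature.MathematicalPhysics.QuantumFieldTheory.Dimock2011to13.ThreeSortedResummation
import Literature.MathematicalPhysics.QuantumFieldTheory.Balaban1983to89.B14RelTreeLength

/-!
# Dimock, *The renormalization group according to Balaban* II, App. E Lemma E.3 = (snow)/(sumsum) —
summability of `e^{−κ d_M(X, mod Ω^c)}` over the polymers with holes through a cube — PROVED for the torus
`d_M(·, mod ·)` of `…ThreeSortedResummation` in every dimension, and the (snow) hypothesis of that module DISCHARGED

**Citation header (reproduction of PUBLISHED work; template of the Balaban lattice Yang–Mills cell).**
J. Dimock, *The renormalization group according to Balaban. II. Large fields*, J. Math. Phys. **54** (2013) 092301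
(= arXiv:1212.5562v2) [Dimock2013BalabanII]: §3.3 eq. (snow) (TeX L1700–1705) and Appendix E
(`\section{disconnected polymer sums}`, L6776) Lemma E.3 `\label{summit}` eq. (sumsum) (L6914–6920) with its proof
(L6923–6955), Lemma E.1 (3) (L6790–6822).  J. Dimock, *… III. Convergence*, Ann. Henri Poincaré **15** (2014) 2133–2175
(= arXiv:1304.0705v1) [Dimock2013BalabanIII], §3.6 (the use of (snow) at TeX L2429–2436).  TeX line numbers refer to the
arXiv sources held by the cell (`inputs/files/dimock/src/1212.5562/*.tex`, `…/1304.0705/1304.0705.tex`); every quotation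
below was read there.  Dimock's papers are published and refereed and are the cell's TEMPLATE, not manuscripts under
audit; no quantity of the Bałaban series is touched.

**Why this module.**  The sibling `…Dimock2011to13.ThreeSortedResummation` (this lineage, gen 15) proves
[Dimock2013BalabanIII] §3.6 from (under2) to Corollary 1 over the cell's torus polymer model, taking (snow) for the
torus `d_M(·, mod ·)` as a hypothesis shape (`ThreeSorted.SummingMod`) and saying: *"NOT discharged here (unit b01's
`B14.RelTreeLength.Window.sumsum` proves the WINDOW analogue on ℤ^d by a relative Steiner-animal count; the periodic
carrier would need the same count through the covering map)"*.  This module does that count.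

**What is PRINTED** ([Dimock2013BalabanII] Lemma E.3 and its proof, verbatim).  *"Let Ω be a union of M-cubes. For □ ⊂ Ω
and constants κ₀, K₀ = 𝒪(1):  Σ_{X ∈ 𝒟_k(mod Ω^c), X ⊃ □} exp(−κ₀ d_M(X, mod Ω^c)) ≤ K₀"* (L6914–6920).  Proof: *"We have
d_M(X, mod Ω^c) ≥ ℓ̃_M(X ∩ Ω) ≥ ½ ℓ_M(X ∩ Ω). Thus it suffices to show Σ_{X ∈ 𝒟_k(mod Ω^c), X ⊃ □} exp(−½κ₀ ℓ_M(X ∩ Ω))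
≤ K₀.  We classify the terms in the sum by the Y = X ∩ Ω they generate. Although X is connected, Y need not be. … Thus
we must estimate the number of polymers X ∈ 𝒟_k(mod Ω) such that X ∩ Ω = Y. If {Ω_α^c} are the connected components
of Ω^c, then any such X can be written X = Y ∪ (∪_α (X ∩ Ω^c_α)). By our assumptions either X ∩ Ω^c_α = ∅ or X ∩ Ω^c_α
= Ω^c_α. Since X is connected each non-empty X ∩ Ω^c_α must have a block sharing a face with a block in Y. Thus the
number of non-empty X ∩ Ω^c_α is at most 2^d |Y|_M. Counting the number of X's generating a particular Y means choosing a
subset of this set. Thus there are less than 2^{2^d|Y|_M} such X. … But |Y|_M ≤ 𝒪(1) ℓ_M(Y) + 𝒪(1) by lemma E.1 and so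
if κ₀ is large enough the sum is bounded by 𝒪(1) Σ_{Y: Y ⊃ □} exp(−¼κ₀ ℓ_M(Y)).  The result now follows by lemma E.2
provided κ₀ > 4a."* (L6923–6955).

**What is PROVED here (kernel-checked; Mathlib + the imported cell modules only).**
* Part 1 — a finite BOX of ℤ^d containing every unit cube met by a polygonal graph (`cbound`, `norm_le_cbound`,
  `mem_box_of_meets`): the compactness step that makes met families of lifted graphs finite.
* Part 2 — THE ANIMAL of a graph of a torus family in the universal cover (`animal` = unit b01's
  `B14.RelTreeLength.met` of the finite lifted family `liftFam`): corner-connected (`isRConnected_animal`, b01's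
  `isRConnected_met`), of volume ≤ `2^d(4 len + 1)` (`card_animal_le`, b01's `card_met_le` = pv22's
  `card_le_of_sAdmissible_len` = the mechanism of Lemma E.1 (3)), projecting into `Ȳ` and onto a superset of the target
  family; **`exists_animal`** — the relative Steiner animal of a torus localization domain modulo holes, through the
  standard lift of a prescribed cube `c ∈ Ȳ ∖ Θ`, with `#A ≤ 2^d(4(d(Ȳ, mod Θ) + ε) + 1)`.
* Part 3 — THE CODE: `Y ↦ (Y ∖ Θ, the set of wall-components of Θ met by Y)` is injective on 𝒟(mod Θ)
  (`eq_of_code_eq`; `mem_of_dMod` = the sibling's component-free `DMod` IS closure along wall-chains in Θ), every met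
  component is wall-adjacent to `Y ∖ Θ` (`exists_exit`, the printed *"sharing a face with a block in Y"*), hence the
  FIBRE COUNT `card_fibre_le`: at most `2^{#P}·2^{2d·#P}` polymers with holes through `c` have `Y ∖ Θ` inside a given
  `P` (print: *"less than 2^{2^d|Y|_M} such X"*).
* Part 4 — **LEMMA E.3 PROVED on the torus** (`sum_exp_torusTreeLenMod_le`): `Σ_{Y∈𝒴} e^{−κ d(Y, mod Θ)} ≤ K₁(d)` for every
  finite family 𝒴 of torus localization domains `Y ∋ c` in 𝒟(mod Θ), `c ∉ Θ`, `κ ≥ κ₁(d) = 2^{d+2} log(2^{2d+2}(3^d+1)²)`,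
  `K₁(d) = e^{κ₁(d)/2}/(3^d+1)²`, by regrouping over the animals and the tree's connected-animal count
  (`Literature.Probability.LatticeModels.sum_pow_card_le_of_connected`, corner adjacency, 3^d-blocks).
* Part 5 — `d = 3`: **`summingMod_of_kappa₁_le`** — the sibling's (snow) shape `ThreeSorted.SummingMod n κ₀ (K₁ 3)` HOLDS
  for `κ₀ ≥ κ₁(3)`; hence `tootBound_of_under2` / `stability_of_under2` = the sibling's theorems with (snow) discharged:
  [Dimock2013BalabanIII] §3.6 is kernel over the cell's polymer model from the shapes (under2) ∧ (stingray) alone, every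
  combinatorial input ((summing0), (snow), Lemma 16, the resummations, Lemma 17's volume bound, the exponentiation)
  being a theorem of the cell's tree-length model.

**Route and divergences (declared).**  (i) The printed proof classifies by the DISCONNECTED `Y = X ∩ Ω` and sums with
Lemma E.2 (disconnected families weighted by `e^{−aℓ_M}`, via Cayley's formula, L6833–6912) after Lemma E.1 (1)–(3); this
module classifies instead by the CONNECTED met-animal of a near-optimal tree of the class (unit b01's device for the
window analogue, `B14RelAnimalBound.relTreeBound` / `B14.RelTreeLength.exists_relAnimal`), so that only Lemma E.1 (3)'s
mechanism and the connected-animal count (= [Dimock2013] App. A (basic1), in the tree) are needed — Lemmas E.1 (1)–(2)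
and E.2 are NOT reproduced.  (ii) Adjacencies: the animal is CORNER-connected in ℤ^d (met families need not be
wall-connected, b01 §3), the holes' components are WALL-components on the torus (print: *"connected components"* with
[Dimock2013] §3.1's face-connectedness; *"sharing a face"*).  (iii) Constants `κ₁(d)`, `K₁(d)` are explicit and not
optimised (print: *"κ₀, K₀ = 𝒪(1)"*, *"if κ₀ is large enough"*); at `d = 3`: `κ₁(3) = 32 log(2⁸·28²)`.  (iv) Geometry in
the universal cover (cell reading D-pv22g2.1): the animal lives in ℤ^d and contains the standard lift `natLift c`; its
projection plays the rôle of the printed `Y ∪ (met blocks)`.  (v) The conventions D-pv22.1 of `torusTreeLen` /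
`torusTreeLenMod` (sup metric, polygonal graphs, infimum) apply.

**What is NOT claimed.**  Lemma E.3 for Dimock's literal `d_M(X, mod Ω^c)` on the continuum torus is asserted only through
the cell's model `torusTreeLenMod` (conventions above); Lemmas E.1 (1)–(2), E.2 and the disconnected lengths `ℓ_M`,
`ℓ′_M` are not formalised; nothing of [Dimock2013BalabanIII] §3.1–3.5 or Theorem 1 is typed; no Bałaban quantity is
touched.  Value = kernel discharge of the last quoted combinatorial leaf of the template's end chain over the cell's
own tree-length model, NOT summit progress (YM₄ on T⁴ / infinite volume / mass gap are elsewhere and out of scope).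

Cell records: TEMPLATE.md §4.3 (row D3 §3.6), §15.1 G5 (entropy of polymers: (basic2)/(snow)/Lemma E.3), §15.2; GAPS.md
C-tmpl15-1 (the sibling); unit `b2b-balaban-template` gen 15, journal claim D2-LEMMA-E3-TORUS-KERNEL.  NEW leaf; imports
`…Dimock2011to13.ThreeSortedResummation` (this lineage) and `…Balaban1983to89.B14RelTreeLength` (unit b01, p177706: `CAdj`,
`met`, `isRConnected_met`, `card_met_le`); sub-namespace `…Dimock2011to13.HoleSummability`; modifies nothing.
-/

noncomputable section

open Real Finset
open Literature.MathematicalPhysics.QuantumFieldTheory.Balaban1983to89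
open Literature.MathematicalPhysics.QuantumFieldTheory.Balaban1983to89.B13ScaleTransfer
open Literature.MathematicalPhysics.QuantumFieldTheory.Balaban1983to89.TreeLength
open Literature.MathematicalPhysics.QuantumFieldTheory.Balaban1983to89.TreeLengthTorus
open Literature.MathematicalPhysics.QuantumFieldTheory.Balaban1983to89.TreeLengthTorusGeometry
open Literature.MathematicalPhysics.QuantumFieldTheory.Balaban1983to89.B12TreeDecay (kappa₀ K₀ K₀_pos)

namespace Literature.MathematicalPhysics.QuantumFieldTheory.Dimock2011to13.HoleSummability

open Literature.MathematicalPhysics.QuantumFieldTheory.Dimock2011to13.ThreeSorted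
open Literature.MathematicalPhysics.QuantumFieldTheory.Balaban1983to89.B14.RelTreeLength
  (CAdj met mem_met met_subset card_met_le isRConnected_met)
open Literature.Probability.LatticeModels
  (IsRConnected rcomponent mem_rcomponent mem_rcomponent_self rcomponent_subset rcomponent_eq_of_mem
    sum_pow_card_le_of_connected)

variable {d N : ℕ}

/-! ## Part 1. A finite box of ℤ^d containing every cube met by a polygonal graph -/

/-- A bound for the sup-norms of the points of a polygonal graph: the maximum of the norms of the endpoints of its
segments (each closed sup-ball is convex). [folklore] -/
def cbound : List (Seg d) → ℝ
  | [] => 0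
  | s :: T => max (max ‖s.1‖ ‖s.2‖) (cbound T)

/-- `0 ≤ cbound T`. [folklore] -/
theorem cbound_nonneg (T : List (Seg d)) : 0 ≤ cbound T := by
  induction T with
  | nil => simp [cbound]
  | cons s T ih => exact ih.trans (le_max_right _ _)

/-- Every point of the carrier of `T` has sup-norm ≤ `cbound T` (segments lie in the closed ball through their
endpoints, `convex_closedBall`). [folklore] -/
theorem norm_le_cbound {T : List (Seg d)} {p : RPt d} (hp : p ∈ carrier T) : ‖p‖ ≤ cbound T := by
  induction T with
  | nil => simp at hp
  | cons s T ih =>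
    rw [carrier_cons] at hp
    rcases hp with hp | hp
    · have h1 : s.1 ∈ Metric.closedBall (0 : RPt d) (max ‖s.1‖ ‖s.2‖) := by
        rw [Metric.mem_closedBall, dist_zero_right]; exact le_max_left _ _
      have h2 : s.2 ∈ Metric.closedBall (0 : RPt d) (max ‖s.1‖ ‖s.2‖) := by
        rw [Metric.mem_closedBall, dist_zero_right]; exact le_max_right _ _
      have h3 := (convex_closedBall (0 : RPt d) (max ‖s.1‖ ‖s.2‖)).segment_subset h1 h2 hp
      rw [Metric.mem_closedBall, dist_zero_right] at h3
      exact h3.trans (le_max_left _ _)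
    · exact (ih hp).trans (le_max_right _ _)

/-- The finite box `[−K, K]^d ⊂ ℤ^d` of cube indices. [folklore] -/
def box (d K : ℕ) : Finset (Pt d) := Fintype.piFinset fun _ : Fin d => Finset.Icc (-(K : ℤ)) K

/-- Every unit cube of ℝ^d met by the graph `T` has its index in the box of half-width `⌈cbound T⌉ + 1` — the
compactness step making the met family of a lifted torus graph a FINITE family of ℤ^d. [folklore] -/
theorem mem_box_of_meets {T : List (Seg d)} {x : Pt d} (hx : (carrier T ∩ cube x).Nonempty) :
    x ∈ box d (⌈cbound T⌉₊ + 1) := by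
  obtain ⟨p, hpT, hpx⟩ := hx
  have hp := norm_le_cbound hpT
  have hK : cbound T ≤ (⌈cbound T⌉₊ : ℝ) := Nat.le_ceil _
  rw [box, Fintype.mem_piFinset]
  intro i
  rw [Finset.mem_Icc]
  have hpi : ‖p i‖ ≤ cbound T := (norm_le_pi_norm p i).trans hp
  rw [Real.norm_eq_abs, abs_le] at hpi
  obtain ⟨h1, h2⟩ := mem_cube.1 hpx i
  have e : (((⌈cbound T⌉₊ + 1 : ℕ) : ℤ) : ℝ) = (⌈cbound T⌉₊ : ℝ) + 1 := by push_cast; ring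
  constructor
  · have h3 : (((-((⌈cbound T⌉₊ + 1 : ℕ) : ℤ)) : ℤ) : ℝ) ≤ ((x i : ℤ) : ℝ) := by
      rw [Int.cast_neg, e]; linarith
    exact_mod_cast h3
  · have h3 : ((x i : ℤ) : ℝ) ≤ (((⌈cbound T⌉₊ + 1 : ℕ) : ℤ) : ℝ) := by
      rw [e]; linarith
    exact_mod_cast h3

/-! ## Part 2. The met family of a graph of a torus family: the relative Steiner animal in the universal cover -/

/-- The cubes of the box projecting into the torus family `Ȳ` (a finite piece of `π⁻¹(Ȳ)`). [folklore] -/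
def liftFam (K : ℕ) (Y : Finset (TPt d N)) : Finset (Pt d) := (box d K).filter fun x => proj N x ∈ Y

/-- Membership in `liftFam`. [folklore] -/
theorem mem_liftFam {K : ℕ} {Y : Finset (TPt d N)} {x : Pt d} : x ∈ liftFam K Y ↔ x ∈ box d K ∧ proj N x ∈ Y :=
  Finset.mem_filter

/-- A graph in `π⁻¹(Ȳ)` (a `TCover Ȳ B` graph) lies in the union of the cubes of `liftFam _ Ȳ` — the hypothesis of unit
b01's met-family lemmas (`B14.RelTreeLength.isRConnected_met`, `card_met_le`). [folklore] -/
theorem carrier_subset_cubes_liftFam {Y B : Finset (TPt d N)} {T : List (Seg d)} (hT : TCover Y B T) :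
    carrier T ⊆ cubes (liftFam (⌈cbound T⌉₊ + 1) Y) := by
  intro p hp
  obtain ⟨x, hxY, hpx⟩ := mem_liftCubes.1 (hT.subset hp)
  exact mem_cubes.2 ⟨x, mem_liftFam.2 ⟨mem_box_of_meets ⟨p, hp, hpx⟩, hxY⟩, hpx⟩

/-- THE ANIMAL OF A GRAPH of a torus family: the cubes of ℤ^d projecting into `Ȳ` and met by the (lifted) graph — unit
b01's `B14.RelTreeLength.met` of the finite lifted family.  This is the set "A" of [Dimock2013BalabanII] App. E's
mechanism as used by unit b01 (`B14.RelAnimal.RelCubeSystem.RelAnimalLeaf`: *"A = the M-cubes of X met by an optimal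
tree"*), here in the universal cover. [cite: Dimock2013BalabanII, App. E Lemma E.1(3) (arXiv:1212.5562v2 TeX L6790–6822)] -/
def animal (Y : Finset (TPt d N)) (T : List (Seg d)) : Finset (Pt d) := met (liftFam (⌈cbound T⌉₊ + 1) Y) T

/-- The animal is CORNER-CONNECTED (`IsRConnected CAdj`, unit b01's `isRConnected_met`: the closed cubes of a
corner-component and of the rest cover the connected carrier). [folklore] -/
theorem isRConnected_animal {Y B : Finset (TPt d N)} {T : List (Seg d)} (hT : TCover Y B T) :
    IsRConnected CAdj (animal Y T) :=
  isRConnected_met hT.connected (carrier_subset_cubes_liftFam hT)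

/-- THE VOLUME OF THE ANIMAL: `#animal ≤ 2^d(4·len T + 1)` — unit b01's `card_met_le` = unit pv22's
`TreeLength.card_le_of_sAdmissible_len`, the mechanism of [Dimock2013BalabanII] App. E Lemma E.1 (3), verbatim: *"|Y|_M ≤
4(2^d+1)(ℓ_M(Y)+1)"* (proof L6820: *"since at most 2^d blocks be mutually touching"*). [cite: Dimock2013BalabanII, App. E Lemma E.1(3) (arXiv:1212.5562v2 TeX L6790–6822)] -/
theorem card_animal_le {Y B : Finset (TPt d N)} {T : List (Seg d)} (hT : TCover Y B T) :
    ((animal Y T).card : ℝ) ≤ 2 ^ d * (4 * len T + 1) :=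
  card_met_le hT.connected

/-- The animal projects into `Ȳ`. [folklore] -/
theorem image_animal_subset (Y : Finset (TPt d N)) (T : List (Seg d)) : (animal Y T).image (proj N) ⊆ Y := by
  intro b hb
  obtain ⟨x, hx, rfl⟩ := Finset.mem_image.1 hb
  exact (mem_liftFam.1 (met_subset _ _ hx)).2

/-- A cube projecting into `Ȳ` and met by the graph belongs to the animal. [folklore] -/
theorem mem_animal_of_meets {Y B : Finset (TPt d N)} {T : List (Seg d)} (_hT : TCover Y B T) {x : Pt d}
    (hxY : proj N x ∈ Y) (hne : (carrier T ∩ cube x).Nonempty) : x ∈ animal Y T :=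
  mem_met.2 ⟨mem_liftFam.2 ⟨mem_box_of_meets hne, hxY⟩, hne⟩

/-- The target family `B ⊆ Ȳ` of a `TCover Ȳ B` graph lies in the projection of its animal (every target cube has a met
lift). [folklore] -/
theorem subset_image_animal {Y B : Finset (TPt d N)} {T : List (Seg d)} (hT : TCover Y B T) (hBY : B ⊆ Y) :
    B ⊆ (animal Y T).image (proj N) := by
  intro b hb
  obtain ⟨x, hxb, hne⟩ := hT.meets b hb
  refine Finset.mem_image.2 ⟨x, mem_animal_of_meets hT ?_ hne, hxb⟩
  rw [hxb]
  exact hBY hb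

section Periodic

variable [NeZero N]

/-- **THE RELATIVE STEINER ANIMAL ON THE TORUS** (the periodic twin of unit b01's `B14.RelTreeLength.exists_relAnimal` /
`Window.relAnimalLeaf`): for a torus localization domain `Ȳ`, holes `Θ`, a cube `c ∈ Ȳ ∖ Θ` and `ε > 0` there is a
corner-connected finite family `A ⊂ ℤ^d` containing the standard lift `natLift c`, with `Ȳ ∖ Θ ⊆ π(A) ⊆ Ȳ` and `#A ≤
2^d(4(d_M(Ȳ, mod Θ) + ε) + 1)` — the animal of a near-optimal graph of the class defining `torusTreeLenMod Ȳ Θ`,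
re-sheeted (`TCover.exists_translate_meets`) to pass through the cube `natLift c`.  This replaces, on the periodic
carrier, the first line of the printed proof of Lemma E.3 (TeX L6923: *"We have d_M(X, mod Ω^c) ≥ ℓ̃_M(X ∩ Ω) ≥ ½ ℓ_M(X ∩
Ω)"*) together with Lemma E.1 (3). [cite: Dimock2013BalabanII, App. E Lemma E.3 (proof) (arXiv:1212.5562v2 TeX L6923–6955)] -/
theorem exists_animal {Y Θ : Finset (TPt d N)} (hY : Y.Nonempty) (hc : TFaceConnected Y) {c : TPt d N}
    (hcY : c ∈ Y) (hcΘ : c ∉ Θ) {ε : ℝ} (hε : 0 < ε) :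
    ∃ A : Finset (Pt d), natLift c ∈ A ∧ IsRConnected CAdj A ∧ Y \ Θ ⊆ A.image (proj N) ∧
      A.image (proj N) ⊆ Y ∧ (A.card : ℝ) ≤ 2 ^ d * (4 * (torusTreeLenMod Y Θ + ε) + 1) := by
  have hne : ∃ T, TAdmissibleMod Y Θ T :=
    exists_tCover_of_dom hY hc (Finset.Subset.refl Y) Finset.sdiff_subset
  obtain ⟨T, hT, hlt⟩ := exists_tCover_len_lt hne hε
  have hcB : c ∈ Y \ Θ := Finset.mem_sdiff.2 ⟨hcY, hcΘ⟩
  obtain ⟨T', hT', hlen, hmeet⟩ := TCover.exists_translate_meets hT hcB (proj_natLift c)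
  refine ⟨animal Y T', mem_animal_of_meets hT' (by rw [proj_natLift]; exact hcY) hmeet, isRConnected_animal hT',
    subset_image_animal hT' Finset.sdiff_subset, image_animal_subset Y T', ?_⟩
  have h1 := card_animal_le hT'
  have h2 : len T' ≤ torusTreeLenMod Y Θ + ε := by rw [hlen]; exact hlt.le
  have h3 : (2 : ℝ) ^ d * (4 * len T' + 1) ≤ 2 ^ d * (4 * (torusTreeLenMod Y Θ + ε) + 1) := by
    have : (0 : ℝ) ≤ 2 ^ d := by positivity
    nlinarith
  exact h1.trans h3

/-! ## Part 3. Coding a polymer with holes by its animal: components of the holes and the fibre count -/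

/-- The wall-components of the holes `Θ` through Θ-cubes wall-adjacent to a cube of `P` — the candidate set of
[Dimock2013BalabanII] L6943–6945, verbatim: *"Since X is connected each non-empty X ∩ Ω^c_α must have a block sharing a face
with a block in Y. Thus the number of non-empty X ∩ Ω^c_α is at most 2^d |Y|_M"* (here: at most `2d·#P`, `2d` = the
number of walls of a cube, pv22 `tdegreeLE`). [cite: Dimock2013BalabanII, App. E Lemma E.3 (proof) (arXiv:1212.5562v2 TeX L6943–6945)] -/
def adjComps (Θ P : Finset (TPt d N)) : Finset (Finset (TPt d N)) :=
  ((P.biUnion tnbr).filter (· ∈ Θ)).image (rcomponent TAdj Θ)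

/-- `#adjComps Θ P ≤ 2d·#P` (print: *"at most 2^d |Y|_M"*). [cite: Dimock2013BalabanII, App. E Lemma E.3 (proof) (arXiv:1212.5562v2 TeX L6943–6945)] -/
theorem card_adjComps_le (Θ P : Finset (TPt d N)) : (adjComps Θ P).card ≤ 2 * d * P.card := by
  classical
  unfold adjComps
  refine Finset.card_image_le.trans ((Finset.card_filter_le _ _).trans ?_)
  refine Finset.card_biUnion_le.trans ?_
  calc ∑ a ∈ P, (tnbr a).card ≤ ∑ _a ∈ P, 2 * d := Finset.sum_le_sum fun a _ => tdegreeLE d N a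
    _ = 2 * d * P.card := by rw [Finset.sum_const, smul_eq_mul, mul_comm]

/-- The wall-components of `Θ` met by `Y` (the non-empty `X ∩ Ω^c_α` of L6937–6942, verbatim: *"any such X can be
written X = Y ∪ (∪_α (X ∩ Ω^c_α)). By our assumptions either X ∩ Ω^c_α = ∅ or X ∩ Ω^c_α = Ω^c_α."*). [cite: Dimock2013BalabanII, App. E Lemma E.3 (proof) (arXiv:1212.5562v2 TeX L6937–6942)] -/
def compSet (Θ Y : Finset (TPt d N)) : Finset (Finset (TPt d N)) := (Y ∩ Θ).image (rcomponent TAdj Θ)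

omit [NeZero N] in
/-- THE LAST EXIT OF A CHAIN — the content of *"Since X is connected each non-empty X ∩ Ω^c_α must have a block sharing
a face with a block in Y"* (L6943–6944): in a torus localization domain `Y` containing a cube `c ∉ Θ`, the
Θ-component of any `a ∈ Y ∩ Θ` has a cube wall-adjacent to a cube of `Y ∖ Θ` (follow a wall-chain from `a` to `c`
inside `Y`; its last cube in the component is adjacent to the first cube outside `Θ`). [cite: Dimock2013BalabanII, App. E Lemma E.3 (proof) (arXiv:1212.5562v2 TeX L6943–6944)] -/
theorem exists_exit {Y Θ : Finset (TPt d N)} (hc : TFaceConnected Y) {c a : TPt d N} (hcY : c ∈ Y)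
    (hcΘ : c ∉ Θ) (haY : a ∈ Y) (haΘ : a ∈ Θ) :
    ∃ u ∈ Y, u ∉ Θ ∧ ∃ v ∈ rcomponent TAdj Θ a, TAdj u v := by
  have key : ∀ z, TLinked Y a z →
      z ∈ rcomponent TAdj Θ a ∨ ∃ u ∈ Y, u ∉ Θ ∧ ∃ v ∈ rcomponent TAdj Θ a, TAdj u v := by
    intro z hz
    unfold TLinked at hz
    induction hz with
    | refl => exact Or.inl (mem_rcomponent_self haΘ)
    | @tail b c' _ hbc ih =>
      rcases ih with hb | hexit
      · by_cases hc'Θ : c' ∈ Θ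
        · left
          exact mem_rcomponent.2 ⟨hc'Θ, (mem_rcomponent.1 hb).2.tail ⟨hbc.2.2, rcomponent_subset _ _ hb, hc'Θ⟩⟩
        · right
          exact ⟨c', hbc.2.1, hc'Θ, b, hb, hbc.2.2.symm⟩
      · exact Or.inr hexit
  rcases key c (hc a haY c hcY) with h | h
  · exact absurd (rcomponent_subset _ _ h) hcΘ
  · exact h

/-- Hence the components met by `Y` are among the components adjacent to any `P ⊇ Y ∖ Θ`. [cite: Dimock2013BalabanII, App. E Lemma E.3 (proof) (arXiv:1212.5562v2 TeX L6943–6945)] -/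
theorem compSet_subset_adjComps {Y Θ P : Finset (TPt d N)} (hc : TFaceConnected Y) {c : TPt d N} (hcY : c ∈ Y)
    (hcΘ : c ∉ Θ) (hP : Y \ Θ ⊆ P) : compSet Θ Y ⊆ adjComps Θ P := by
  classical
  intro C hC
  obtain ⟨a, ha, rfl⟩ := Finset.mem_image.1 hC
  obtain ⟨haY, haΘ⟩ := Finset.mem_inter.1 ha
  obtain ⟨u, huY, huΘ, v, hv, huv⟩ := exists_exit hc hcY hcΘ haY haΘ
  refine Finset.mem_image.2 ⟨v, Finset.mem_filter.2 ⟨Finset.mem_biUnion.2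
    ⟨u, hP (Finset.mem_sdiff.2 ⟨huY, huΘ⟩), mem_tnbr.2 huv⟩, rcomponent_subset _ _ hv⟩, ?_⟩
  exact rcomponent_eq_of_mem (fun _ _ h => h.symm) hv

omit [NeZero N] in
/-- `DMod Θ Y` (the component-free 𝒟_k(mod Ω^c) of `…ThreeSortedResummation`) IS closure under wall-chains inside `Θ`:
a polymer with holes containing `a ∈ Θ` contains the whole Θ-component of `a` (*"either X ∩ Ω^c_α = ∅ or X ∩ Ω^c_α =
Ω^c_α"*, L6941–6942) — the reading (iv) of the sibling module made a theorem in the direction used. [cite: Dimock2013BalabanII, §3.3 (arXiv:1212.5562v2 TeX L1680–1687)] -/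
theorem mem_of_dMod {Θ Y : Finset (TPt d N)} (hD : DMod Θ Y) {a b : TPt d N} (haY : a ∈ Y)
    (hb : b ∈ rcomponent TAdj Θ a) : b ∈ Y := by
  obtain ⟨-, hchain⟩ := mem_rcomponent.1 hb
  clear hb
  induction hchain with
  | refl => exact haY
  | @tail x y _ hxy ih => exact (hD x hxy.2.1 y hxy.2.2 hxy.1).1 ih

omit [NeZero N] in
/-- **`DMod` ⟺ THE PRINTED COMPONENT FORM** (reading (iv) of `…ThreeSortedResummation` made a theorem; cross-read
advisory C-pv18g10-1 A3): `X ∩ Θ` is closed under wall-adjacency inside `Θ` iff every wall-component of `Θ` is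
contained in `X` or disjoint from `X` — [Dimock2013BalabanII] §3.3, verbatim (TeX L1684–1687): *"𝒟_k(mod Ω^c_k) = {X ⊂
𝒟_k : for all α either Ω^c_{k,α} ⊂ X or Ω^c_{k,α}, X are disjoint}"*. [cite: Dimock2013BalabanII, §3.3 (arXiv:1212.5562v2 TeX L1680–1687)] -/
theorem dMod_iff_components {Θ Y : Finset (TPt d N)} :
    DMod Θ Y ↔ ∀ a ∈ Θ, rcomponent TAdj Θ a ⊆ Y ∨ Disjoint (rcomponent TAdj Θ a) Y := by
  constructor
  · intro hD a _
    by_cases h : Disjoint (rcomponent TAdj Θ a) Y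
    · exact Or.inr h
    · left
      obtain ⟨a', ha'C, ha'Y⟩ := Finset.not_disjoint_iff.1 h
      intro b hb
      have hba : b ∈ rcomponent TAdj Θ a' := by
        rw [rcomponent_eq_of_mem (fun _ _ h => h.symm) ha'C]
        exact hb
      exact mem_of_dMod hD ha'Y hba
  · intro h a ha b hb hab
    have hbC : b ∈ rcomponent TAdj Θ a :=
      mem_rcomponent.2 ⟨hb, Relation.ReflTransGen.single ⟨hab, ha, hb⟩⟩
    have haC : a ∈ rcomponent TAdj Θ b :=
      mem_rcomponent.2 ⟨ha, Relation.ReflTransGen.single ⟨hab.symm, hb, ha⟩⟩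
    constructor
    · intro haY
      rcases h a ha with hsub | hdis
      · exact hsub hbC
      · exact absurd haY (Finset.disjoint_left.1 hdis (mem_rcomponent_self ha))
    · intro hbY
      rcases h b hb with hsub | hdis
      · exact hsub haC
      · exact absurd hbY (Finset.disjoint_left.1 hdis (mem_rcomponent_self hb))

omit [NeZero N] in
/-- One inclusion of the coding injectivity (L6945–6946: *"Counting the number of X's generating a particular Y means
choosing a subset of this set"*): a polymer with holes is determined by its part outside `Θ` and the set of
Θ-components it meets. [cite: Dimock2013BalabanII, App. E Lemma E.3 (proof) (arXiv:1212.5562v2 TeX L6945–6946)] -/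
theorem subset_of_code_eq {Θ Y Y' : Finset (TPt d N)} (hD' : DMod Θ Y') (h1 : Y \ Θ = Y' \ Θ)
    (h2 : compSet Θ Y = compSet Θ Y') : Y ⊆ Y' := by
  classical
  intro a haY
  by_cases haΘ : a ∈ Θ
  · have hmem : rcomponent TAdj Θ a ∈ compSet Θ Y' := by
      rw [← h2]
      exact Finset.mem_image.2 ⟨a, Finset.mem_inter.2 ⟨haY, haΘ⟩, rfl⟩
    obtain ⟨a', ha', heq⟩ := Finset.mem_image.1 hmem
    have ha_in : a ∈ rcomponent TAdj Θ a' := by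
      rw [heq]
      exact mem_rcomponent_self haΘ
    exact mem_of_dMod hD' (Finset.mem_inter.1 ha').1 ha_in
  · have h3 : a ∈ Y \ Θ := Finset.mem_sdiff.2 ⟨haY, haΘ⟩
    rw [h1] at h3
    exact (Finset.mem_sdiff.1 h3).1

omit [NeZero N] in
/-- THE CODE `Y ↦ (Y ∖ Θ, compSet Θ Y)` IS INJECTIVE on the polymers with holes `Θ`. [cite: Dimock2013BalabanII, App. E Lemma E.3 (proof) (arXiv:1212.5562v2 TeX L6945–6946)] -/
theorem eq_of_code_eq {Θ Y Y' : Finset (TPt d N)} (hD : DMod Θ Y) (hD' : DMod Θ Y') (h1 : Y \ Θ = Y' \ Θ)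
    (h2 : compSet Θ Y = compSet Θ Y') : Y = Y' :=
  Finset.Subset.antisymm (subset_of_code_eq hD' h1 h2) (subset_of_code_eq hD h1.symm h2.symm)

/-- **THE FIBRE COUNT** — [Dimock2013BalabanII] L6945–6946, verbatim: *"Thus the number of non-empty X ∩ Ω^c_α is at most
2^d |Y|_M. Counting the number of X's generating a particular Y means choosing a subset of this set. Thus there are less
than 2^{2^d|Y|_M} such X."* — here, coding by an animal-projection `P ⊇ Y ∖ Θ` instead of by `Y ∖ Θ` itself: the number
of torus localization domains `Y ∋ c` (`c ∉ Θ`) in 𝒟(mod Θ) with `Y ∖ Θ ⊆ P` is at most `2^{#P} · 2^{2d·#P}` (choice of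
`Y ∖ Θ ⊆ P` times choice of a set of adjacent components). [cite: Dimock2013BalabanII, App. E Lemma E.3 (proof) (arXiv:1212.5562v2 TeX L6936–6946)] -/
theorem card_fibre_le {Θ : Finset (TPt d N)} {c : TPt d N} (𝒴 : Finset (Finset (TPt d N)))
    (h𝒴 : ∀ Y ∈ 𝒴, TFaceConnected Y ∧ c ∈ Y ∧ c ∉ Θ ∧ DMod Θ Y) (P : Finset (TPt d N))
    (hP : ∀ Y ∈ 𝒴, Y \ Θ ⊆ P) : 𝒴.card ≤ 2 ^ P.card * 2 ^ (2 * d * P.card) := by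
  classical
  have hinj : Set.InjOn (fun Y : Finset (TPt d N) => (Y \ Θ, compSet Θ Y)) ↑𝒴 := by
    intro Y hY Y' hY' h
    simp only [Prod.mk.injEq] at h
    exact eq_of_code_eq (h𝒴 Y hY).2.2.2 (h𝒴 Y' hY').2.2.2 h.1 h.2
  have hmaps : ∀ Y ∈ 𝒴, (fun Y : Finset (TPt d N) => (Y \ Θ, compSet Θ Y)) Y ∈
      P.powerset ×ˢ (adjComps Θ P).powerset := by
    intro Y hY
    obtain ⟨hconn, hcY, hcΘ, -⟩ := h𝒴 Y hY
    exact Finset.mem_product.2 ⟨Finset.mem_powerset.2 (hP Y hY),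
      Finset.mem_powerset.2 (compSet_subset_adjComps hconn hcY hcΘ (hP Y hY))⟩
  calc 𝒴.card ≤ (P.powerset ×ˢ (adjComps Θ P).powerset).card := Finset.card_le_card_of_injOn _ hmaps hinj
    _ = 2 ^ P.card * 2 ^ (adjComps Θ P).card := by
        rw [Finset.card_product, Finset.card_powerset, Finset.card_powerset]
    _ ≤ 2 ^ P.card * 2 ^ (2 * d * P.card) :=
        Nat.mul_le_mul_left _ (Nat.pow_le_pow_right (by norm_num) (card_adjComps_le Θ P))

/-! ## Part 4. Lemma E.3 = (snow)/(sumsum) for the torus `d_M(·, mod ·)`, PROVED in every dimension -/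

/-- The rate threshold `κ₁(d) := 2^{d+2} · log(2^{2d+2}(3^d+1)²)` — "κ₀ large enough" of L6951/L6955 (*"if κ₀ is large
enough … provided κ₀ > 4a"*) made explicit for this module's route: at `κ₁` the activity `2^{2d+1} e^{−κ₁/2^{d+2}}` of a
corner-connected animal cube equals the Kotecký–Preiss smallness value `1/(2(3^d+1)²)` of the tree's animal count
(`Literature.Probability.LatticeModels.sum_pow_card_le_of_connected` with Δ = 3^d). [cite: Dimock2013BalabanII, App. E Lemma E.3 (arXiv:1212.5562v2 TeX L6951–6955)] -/
noncomputable def kappa₁ (d : ℕ) : ℝ := 2 ^ (d + 2) * Real.log (2 ^ (2 * d + 2) * ((3 : ℝ) ^ d + 1) ^ 2)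

/-- The constant `K₁(d) := e^{κ₁(d)/2}/(3^d+1)²` of this module's (sumsum) (print: *"K₀ = 𝒪(1)"*). [cite: Dimock2013BalabanII, App. E Lemma E.3 (arXiv:1212.5562v2 TeX L6914–6920)] -/
noncomputable def K₁ (d : ℕ) : ℝ := Real.exp (kappa₁ d / 2) / ((3 : ℝ) ^ d + 1) ^ 2

/-- `0 ≤ κ₁(d)`. [folklore] -/
theorem kappa₁_nonneg (d : ℕ) : 0 ≤ kappa₁ d := by
  unfold kappa₁
  refine mul_nonneg (by positivity) (Real.log_nonneg ?_)
  have h1 : (1 : ℝ) ≤ 2 ^ (2 * d + 2) := one_le_pow₀ (by norm_num)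
  have h2 : (1 : ℝ) ≤ ((3 : ℝ) ^ d + 1) ^ 2 := by
    have : (1 : ℝ) ≤ (3 : ℝ) ^ d + 1 := by
      have : (0 : ℝ) ≤ (3 : ℝ) ^ d := by positivity
      linarith
    nlinarith
  nlinarith

/-- `0 < K₁(d)`. [folklore] -/
theorem K₁_pos (d : ℕ) : 0 < K₁ d := by
  unfold K₁
  positivity

/-- The Kotecký–Preiss smallness at `κ₁`: `(3^d+1)² · 2^{2d+1} e^{−κ₁/2^{d+2}} ≤ ½` (in fact equality). [folklore] -/
theorem smallness_kappa₁ (d : ℕ) :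
    (((3 ^ d : ℕ) : ℝ) + 1) ^ 2 * (2 ^ (2 * d + 1) * Real.exp (-(kappa₁ d / 2 ^ (d + 2)))) ≤ 1 / 2 := by
  have hM : (0 : ℝ) < 2 ^ (2 * d + 2) * ((3 : ℝ) ^ d + 1) ^ 2 := by positivity
  have hexp : Real.exp (-(kappa₁ d / 2 ^ (d + 2))) = (2 ^ (2 * d + 2) * ((3 : ℝ) ^ d + 1) ^ 2)⁻¹ := by
    have h2 : (2 : ℝ) ^ (d + 2) ≠ 0 := by positivity
    rw [kappa₁, mul_div_cancel_left₀ _ h2, Real.exp_neg, Real.exp_log hM]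
  rw [hexp]
  push_cast
  rw [show (2 : ℝ) ^ (2 * d + 2) = 2 * 2 ^ (2 * d + 1) by ring]
  field_simp
  ring_nf
  exact le_rfl

/-- **[Dimock2013BalabanII] LEMMA E.3 = (snow)/(sumsum), PROVED FOR THE TORUS `d_M(·, mod ·)` IN EVERY DIMENSION** — verbatim
(TeX L6914–6920): *"Let Ω be a union of M-cubes. For □ ⊂ Ω and constants κ₀, K₀ = 𝒪(1):  Σ_{X ∈ 𝒟_k(mod Ω^c), X ⊃ □}
exp(−κ₀ d_M(X, mod Ω^c)) ≤ K₀"* (= §3.3 (snow), L1700–1705).  Typed: for holes `Θ`, a cube `c ∉ Θ`, any finite family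
𝒴 of torus localization domains `Y ∋ c` with `DMod Θ Y`, and `κ ≥ κ₁(d)`:  `Σ_{Y∈𝒴} e^{−κ d(Y, mod Θ)} ≤ K₁(d)`.  PROOF
(the printed classification L6930–6946 with unit b01's animal device in place of Lemmas E.1(1)/E.2): (0) `κ ↦ κ₁`
(monotonicity, `d(Y, mod Θ) ≥ 0`); (1) each `Y` gets a corner-connected animal `A_Y ∋ natLift c` in ℤ^d with `Y ∖ Θ ⊆
π(A_Y) ⊆ Y`, `#A_Y ≤ 2^d(4 d(Y, mod Θ) + 2)` (`exists_animal`, ε = ¼), whence `e^{−κ₁ d} ≤ e^{κ₁/2} μ^{#A_Y}`, `μ =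
e^{−κ₁/2^{d+2}}`; (2) regroup by the animal (`Finset.sum_fiberwise_of_maps_to`); the fibre of `A` has ≤ `2^{#A}·2^{2d·#A}`
members (`card_fibre_le` with `P = π(A)`, `#π(A) ≤ #A`) — print: *"less than 2^{2^d|Y|_M} such X"*; (3) the resulting
`Σ_A (2^{2d+1}μ)^{#A}` over corner-connected animals through `natLift c` is ≤ `2·2^{2d+1}μ` by the tree's
connected-animal count (`sum_pow_card_le_of_connected`, R = `CAdj`, neighbourhoods = the 3^d-blocks
`B13ScaleTransfer.block`, smallness `smallness_kappa₁`) — print: *"The result now follows by lemma E.2 provided κ₀ >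
4a"* (Lemma E.2 = the DISCONNECTED-family count via Cayley's formula; replaced here by the connected count, as in unit
b01's `B14RelAnimalBound.relTreeBound` for the window analogue); (4) `e^{κ₁/2}·2·2^{2d+1}μ(κ₁) = K₁(d)`.  Divergences
declared: constants (`κ₁(d)`, `K₁(d)` explicit, not optimal); animals in the universal cover instead of `Y = X ∩ Ω` on
the torus; corner adjacency for the animal (met families are only corner-connected, b01 §3), wall adjacency for the
holes' components (print: *"sharing a face"*). [cite: Dimock2013BalabanII, App. E Lemma E.3 (arXiv:1212.5562v2 TeX L6914–6955)] -/
theorem sum_exp_torusTreeLenMod_le (Θ : Finset (TPt d N)) {c : TPt d N} (hcΘ : c ∉ Θ)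
    (𝒴 : Finset (Finset (TPt d N))) (h𝒴 : ∀ Y ∈ 𝒴, Y.Nonempty ∧ TFaceConnected Y ∧ c ∈ Y ∧ DMod Θ Y)
    {κ : ℝ} (hκ : kappa₁ d ≤ κ) :
    ∑ Y ∈ 𝒴, Real.exp (-κ * torusTreeLenMod Y Θ) ≤ K₁ d := by
  classical
  set κ₁ := kappa₁ d with hκ₁
  set μ : ℝ := Real.exp (-(κ₁ / 2 ^ (d + 2))) with hμ
  have hμ0 : 0 ≤ μ := (Real.exp_pos _).le
  -- Step 0: monotonicity in κ
  have step0 : ∑ Y ∈ 𝒴, Real.exp (-κ * torusTreeLenMod Y Θ) ≤ ∑ Y ∈ 𝒴, Real.exp (-κ₁ * torusTreeLenMod Y Θ) := by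
    refine Finset.sum_le_sum fun Y _ => Real.exp_le_exp.2 ?_
    have := torusTreeLenMod_nonneg Y Θ
    nlinarith
  refine step0.trans ?_
  -- Step 1: animals
  have hA : ∀ Y ∈ 𝒴, ∃ A : Finset (Pt d), natLift c ∈ A ∧ IsRConnected CAdj A ∧ Y \ Θ ⊆ A.image (proj N) ∧
      A.image (proj N) ⊆ Y ∧ (A.card : ℝ) ≤ 2 ^ d * (4 * (torusTreeLenMod Y Θ + 1 / 4) + 1) := fun Y hY =>
    exists_animal (h𝒴 Y hY).1 (h𝒴 Y hY).2.1 (h𝒴 Y hY).2.2.1 hcΘ (by norm_num)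
  choose! anim hc1 hc2 hc3 hc4 hc5 using hA
  -- Step 2: termwise bound exp(−κ₁ dmod) ≤ e^{κ₁/2} μ^{#A}
  have hterm : ∀ Y ∈ 𝒴, Real.exp (-κ₁ * torusTreeLenMod Y Θ) ≤ Real.exp (κ₁ / 2) * μ ^ (anim Y).card := by
    intro Y hY
    have h5 := hc5 Y hY
    have hk0 : 0 ≤ κ₁ := kappa₁_nonneg d
    have hpow : μ ^ (anim Y).card = Real.exp (-(κ₁ / 2 ^ (d + 2)) * (anim Y).card) := by
      rw [hμ, ← Real.exp_nat_mul]; ring_nf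
    rw [hpow, ← Real.exp_add, Real.exp_le_exp]
    -- from h5: 2^(d+2) dmod ≥ #A − 2^d·2  ⇒ −κ₁ dmod ≤ κ₁/2 − κ₁ #A / 2^(d+2)
    have h2d : (0 : ℝ) < 2 ^ (d + 2) := by positivity
    have h6 : ((anim Y).card : ℝ) ≤ 2 ^ (d + 2) * torusTreeLenMod Y Θ + 2 ^ (d + 2) / 2 := by
      have : (2 : ℝ) ^ d * (4 * (torusTreeLenMod Y Θ + 1 / 4) + 1)
          = 2 ^ (d + 2) * torusTreeLenMod Y Θ + 2 ^ (d + 2) / 2 := by ring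
      linarith
    have h7 : κ₁ / 2 ^ (d + 2) * ((anim Y).card : ℝ) ≤ κ₁ * torusTreeLenMod Y Θ + κ₁ / 2 := by
      have := mul_le_mul_of_nonneg_left h6 (div_nonneg hk0 h2d.le)
      have e : κ₁ / 2 ^ (d + 2) * (2 ^ (d + 2) * torusTreeLenMod Y Θ + 2 ^ (d + 2) / 2)
          = κ₁ * torusTreeLenMod Y Θ + κ₁ / 2 := by field_simp
      linarith
    linarith
  -- Step 3: regroup by the animal
  set 𝒜 := 𝒴.image anim with h𝒜
  have hfib : ∑ Y ∈ 𝒴, μ ^ (anim Y).card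
      = ∑ A ∈ 𝒜, ((𝒴.filter (fun Y => anim Y = A)).card : ℝ) * μ ^ A.card := by
    rw [← Finset.sum_fiberwise_of_maps_to (s := 𝒴) (t := 𝒜) (g := anim)
      (fun Y hY => Finset.mem_image_of_mem _ hY)]
    refine Finset.sum_congr rfl fun A _ => ?_
    rw [Finset.sum_congr rfl (fun Y hY => by rw [(Finset.mem_filter.1 hY).2]), Finset.sum_const, nsmul_eq_mul]
  -- Step 4: the fibre count ≤ 2^{(2d+1)#A}
  have hcount : ∀ A ∈ 𝒜, ((𝒴.filter (fun Y => anim Y = A)).card : ℝ) * μ ^ A.card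
      ≤ (2 ^ (2 * d + 1) * μ) ^ A.card := by
    intro A _
    set P := A.image (proj N) with hP
    have hPc : P.card ≤ A.card := Finset.card_image_le
    have hF : ∀ Y ∈ 𝒴.filter (fun Y => anim Y = A), TFaceConnected Y ∧ c ∈ Y ∧ c ∉ Θ ∧ DMod Θ Y := by
      intro Y hY
      obtain ⟨hY𝒴, -⟩ := Finset.mem_filter.1 hY
      exact ⟨(h𝒴 Y hY𝒴).2.1, (h𝒴 Y hY𝒴).2.2.1, hcΘ, (h𝒴 Y hY𝒴).2.2.2⟩
    have hFP : ∀ Y ∈ 𝒴.filter (fun Y => anim Y = A), Y \ Θ ⊆ P := by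
      intro Y hY
      obtain ⟨hY𝒴, hYA⟩ := Finset.mem_filter.1 hY
      rw [hP, ← hYA]
      exact hc3 Y hY𝒴
    have hnat := card_fibre_le (𝒴.filter (fun Y => anim Y = A)) hF P hFP
    have hreal : ((𝒴.filter (fun Y => anim Y = A)).card : ℝ) ≤ (2 : ℝ) ^ A.card * 2 ^ (2 * d * A.card) := by
      have h1 : ((𝒴.filter (fun Y => anim Y = A)).card : ℝ) ≤ (2 : ℝ) ^ P.card * 2 ^ (2 * d * P.card) := by
        exact_mod_cast hnat
      have h2 : (2 : ℝ) ^ P.card ≤ 2 ^ A.card := pow_le_pow_right₀ (by norm_num) hPc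
      have h3 : (2 : ℝ) ^ (2 * d * P.card) ≤ 2 ^ (2 * d * A.card) :=
        pow_le_pow_right₀ (by norm_num) (Nat.mul_le_mul_left _ hPc)
      calc _ ≤ (2 : ℝ) ^ P.card * 2 ^ (2 * d * P.card) := h1
        _ ≤ 2 ^ A.card * 2 ^ (2 * d * A.card) := mul_le_mul h2 h3 (by positivity) (by positivity)
    calc ((𝒴.filter (fun Y => anim Y = A)).card : ℝ) * μ ^ A.card
        ≤ ((2 : ℝ) ^ A.card * 2 ^ (2 * d * A.card)) * μ ^ A.card :=
          mul_le_mul_of_nonneg_right hreal (pow_nonneg hμ0 _)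
      _ = (2 ^ (2 * d + 1) * μ) ^ A.card := by
          rw [mul_pow, ← pow_mul, ← pow_add]
          congr 1
          ring
  -- Step 5: the lattice-animal bound in ℤ^d (corner adjacency, neighbourhoods = the 3^d blocks)
  have h𝒜conn : ∀ A ∈ 𝒜, natLift c ∈ A ∧ IsRConnected CAdj A := by
    intro A hA
    obtain ⟨Y, hY, rfl⟩ := Finset.mem_image.1 hA
    exact ⟨hc1 Y hY, hc2 Y hY⟩
  have hν0 : 0 ≤ 2 ^ (2 * d + 1) * μ := by positivity
  have hsmall : (((3 ^ d : ℕ) : ℝ) + 1) ^ 2 * (2 ^ (2 * d + 1) * μ) ≤ 1 / 2 := smallness_kappa₁ d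
  have hanimal : ∑ A ∈ 𝒜, (2 ^ (2 * d + 1) * μ) ^ A.card ≤ 2 * (2 ^ (2 * d + 1) * μ) :=
    sum_pow_card_le_of_connected (R := CAdj) (nbr := B13ScaleTransfer.block) (Δ := 3 ^ d)
      (fun _ _ h => h.symm) (fun x => (B13ScaleTransfer.card_block x).le) (fun _ _ h => h.2) hν0 hsmall
      (natLift c) 𝒜 h𝒜conn
  -- Step 6: assemble
  have hK : Real.exp (κ₁ / 2) * (2 * (2 ^ (2 * d + 1) * μ)) = K₁ d := by
    have hM : (0 : ℝ) < 2 ^ (2 * d + 2) * ((3 : ℝ) ^ d + 1) ^ 2 := by positivity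
    have hexp : μ = (2 ^ (2 * d + 2) * ((3 : ℝ) ^ d + 1) ^ 2)⁻¹ := by
      have h2 : (2 : ℝ) ^ (d + 2) ≠ 0 := by positivity
      rw [hμ, hκ₁, kappa₁, mul_div_cancel_left₀ _ h2, Real.exp_neg, Real.exp_log hM]
    rw [hexp, K₁, hκ₁]
    have h3 : ((3 : ℝ) ^ d + 1) ^ 2 ≠ 0 := by positivity
    field_simp
    ring
  calc ∑ Y ∈ 𝒴, Real.exp (-κ₁ * torusTreeLenMod Y Θ)
      ≤ ∑ Y ∈ 𝒴, Real.exp (κ₁ / 2) * μ ^ (anim Y).card := Finset.sum_le_sum hterm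
    _ = Real.exp (κ₁ / 2) * ∑ Y ∈ 𝒴, μ ^ (anim Y).card := by rw [Finset.mul_sum]
    _ = Real.exp (κ₁ / 2) * ∑ A ∈ 𝒜, ((𝒴.filter (fun Y => anim Y = A)).card : ℝ) * μ ^ A.card := by rw [hfib]
    _ ≤ Real.exp (κ₁ / 2) * ∑ A ∈ 𝒜, (2 ^ (2 * d + 1) * μ) ^ A.card :=
        mul_le_mul_of_nonneg_left (Finset.sum_le_sum hcount) (Real.exp_pos _).le
    _ ≤ Real.exp (κ₁ / 2) * (2 * (2 ^ (2 * d + 1) * μ)) :=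
        mul_le_mul_of_nonneg_left hanimal (Real.exp_pos _).le
    _ = K₁ d := hK

end Periodic

/-! ## Part 5. `d = 3`: the (snow) shape of `…ThreeSortedResummation` DISCHARGED, and the end chain without it -/

section Three

variable {n : ℕ} [NeZero n]

/-- **(snow) DISCHARGED at `d = 3`**: the hypothesis shape `ThreeSorted.SummingMod n κ₀ (K₁ 3)` of
`…ThreeSortedResummation` HOLDS for every `κ₀ ≥ κ₁(3)` (`modPolymersAt Θ c` = polymers `Y ∋ c` with `DMod Θ Y`, `c ∉ Θ`).
[cite: Dimock2013BalabanII, §3.3 eq. (snow) and App. E Lemma E.3 (arXiv:1212.5562v2 TeX L1700–1705, L6914–6920)] -/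
theorem summingMod_of_kappa₁_le (n : ℕ) [NeZero n] {κ₀ : ℝ} (hκ : kappa₁ 3 ≤ κ₀) :
    SummingMod n κ₀ (K₁ 3) := by
  intro Θ c hcΘ
  refine sum_exp_torusTreeLenMod_le Θ hcΘ (modPolymersAt Θ c) (fun Y hY => ?_) hκ
  obtain ⟨⟨h1, h2⟩, h3, h4⟩ := mem_modPolymersAt.1 hY
  exact ⟨h1, h2, h3, h4⟩

/-- **(under2) ⇒ (toot) WITHOUT the (snow) hypothesis**: `ThreeSorted.tootBound_of_under2` with `SummingMod`
discharged by `summingMod_of_kappa₁_le` — from the (under2) shape alone (plus `κ₀(32,6) ≤ κ₀`, `κ₁(3) ≤ κ₀ ≤ κ′`, `0 < λ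
≤ 1`, `β ≤ n₀`, `λ^{β/2} e^{2(κ′−κ₀)} ≤ 1`) the (toot) shape holds with `𝒪(1) = K₀(32,6) + C·K₀(32,6) + C·K₁(3)`.
[cite: Dimock2013BalabanIII, §3.6 (under2)–(toot) (arXiv:1304.0705v1 TeX L2399–2441)] -/
theorem tootBound_of_under2 {K : TDom 3 n → ℝ} {C lam β κ' κ₀ : ℝ} {n₀ : ℕ}
    (hK : Under2Bound n K C lam β κ' n₀) (hκ₀ : kappa₀ 32 6 ≤ κ₀) (hκ₁ : kappa₁ 3 ≤ κ₀)
    (hκ : κ₀ ≤ κ') (hC : 0 ≤ C) (hlam : 0 < lam) (hlam1 : lam ≤ 1) (hβn₀ : β ≤ n₀)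
    (hsmall : lam ^ (β / 2) * Real.exp (2 * (κ' - κ₀)) ≤ 1) :
    TootBound n K (K₀ 32 6 + C * K₀ 32 6 + C * K₁ 3) lam β (κ' - κ₀ - 1) :=
  ThreeSorted.tootBound_of_under2 hK (summingMod_of_kappa₁_le n hκ₁) hκ₀ hκ hC (K₁_pos 3).le hlam hlam1
    hβn₀ hsmall

/-- **(stingray) ∧ (under2) ⇒ COROLLARY 1 over the cell's polymer model, the ONLY shapes left being (stingray) and
(under2)** (the outputs of [Dimock2013BalabanIII] §3.1–3.5): `ThreeSorted.stability_of_under2` with the (snow) shape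
discharged.  With this, every COMBINATORIAL input of §3.6 — (summing0), (snow), Lemma 16, the three resummations, the
volume bound of Lemma 17, the Kotecký–Preiss exponentiation — is a theorem of the cell's tree-length model.
[cite: Dimock2013BalabanIII, §3.6 (arXiv:1304.0705v1 TeX L2346–2505)] -/
theorem stability_of_under2 {L m Mv N : ℕ} [NeZero L] [NeZero (L ^ (Mv - m))] {lam ε₀ μ₀ : ℝ}
    {K : TDom 3 (L ^ (Mv - m)) → ℝ} {C β κ' κ₀ r₁ : ℝ} {n₀ : ℕ} (hm : m ≤ Mv)
    (hrep : ComponentRepresentation L Mv N (L ^ (Mv - m)) lam ε₀ μ₀ K)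
    (hK : Under2Bound (L ^ (Mv - m)) K C lam β κ' n₀)
    (hκ₀ : kappa₀ 32 6 ≤ κ₀) (hκ₁ : kappa₁ 3 ≤ κ₀) (hκ : κ₀ ≤ κ') (hC : 0 ≤ C) (hlam : 0 < lam)
    (hlam1 : lam ≤ 1) (hβn₀ : β ≤ n₀) (hsmall : lam ^ (β / 2) * Real.exp (2 * (κ' - κ₀)) ≤ 1)
    (htoot : 32 * (K₀ 32 6 + C * K₀ 32 6 + C * K₁ 3) * lam ^ (β / 2) ≤ 1)
    (hr₁ : kappa₀ 32 6 ≤ r₁) (hrate : r₁ + 2 * kappa₀ 32 6 + 2 ≤ κ' - κ₀ - 1)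
    (hKP : Real.exp (1 / 4) * lam ^ (β / 2) * Real.exp (5 * r₁ + 1) * K₀ 32 6 * 32 ≤ 1)
    (hM : Real.exp 1 * 32 * K₀ 32 6 ^ 2 * Real.exp (1 / 4) * K₀ 32 6 ≤ ((L : ℝ) ^ m) ^ 3) :
    Real.exp (-(lam ^ (β / 2) * (L : ℝ) ^ (3 * Mv))) ≤ relativePartitionFunction L Mv N 1 lam ε₀ μ₀ ∧
      relativePartitionFunction L Mv N 1 lam ε₀ μ₀ ≤ Real.exp (lam ^ (β / 2) * (L : ℝ) ^ (3 * Mv)) :=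
  ThreeSorted.stability_of_under2 hm hrep hK (summingMod_of_kappa₁_le _ hκ₁) hκ₀ hκ hC (K₁_pos 3).le hlam
    hlam1 hβn₀ hsmall htoot hr₁ hrate hKP hM

end Three

end Literature.MathematicalPhysics.QuantumFieldTheory.Dimock2011to13.HoleSummability

end
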